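import Summits.HodgeConjecture.HodgeConjecture.Theorems.VHCAbelianSchemesRoadRegimeDefs
import Literature.AlgebraicGeometry.HodgeTheory.MotivatedClasses
import HarnessLib

/-!
# Road b02 (`VHCAbelianSchemesRoad`, D-0059) — THE PER-VARIETY DESIGN PROBLEMS of a cell `(n, p)` of K-SR♭∃ (definitions only)

research route conditional on HC_CM; not a corollary; Q11.4-sentence-2 already refuted in dim ≥ 3.

DEFINITIONS ONLY (nothing asserted, nothing proved, `HC_CM` absent). The cells `LefAtExceptionalRegimeAt 𝒪 n p` of the road's crux
(`VHCAbelianSchemesRoadRegimeDefs` §2; the crux `SemiregularSheafRepresentativesTwAtDiag`, item stmt-HodgeConjecture-19787, is the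
conjunction of the diagonal cells `(2m, m)`, `m ≥ 2`, for the twisted door) are statements about ONE-PARAMETER ABELIAN SCHEMES: a datum is
demanded at SOME fibre of every pencil carrying a somewhere-exceptional class. The route's «why it might fail» names the obstruction as a
«pinned design problem per cell» — a statement about ONE abelian variety. This file types the two per-variety statements between which the
companion proof files (`VHCAbelianSchemesRoadDesignSufficient`, `…DesignNecessary`) SANDWICH every cell, door-generically and fact-free:

* `PinnedDesignAt 𝒪 n p` — the PINNED DESIGN PROBLEM (sufficient side): on every complex scheme `X` isomorphic to an abelian variety of
  dimension `n`, for every polarisation class `θ ∈ H²(X(ℂ); ℂ)` (`IsPolarizationClass`: rational, supported on a divisor, hard Lefschetz) and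
  every RATIONAL ALGEBRAIC class `w ∈ H^{2p}(X(ℂ); ℂ)`, there is an `𝒪`-admissible datum `(I ∋ p, κ)` ON `X` ITSELF with
  `κ_p = a·w + c_p·θᵖ`, `a ≠ 0`, and every other component on the `θ`-ray, `κ_q = c_q·θ^q` (`q ∈ I`, `q ≠ p`). It implies K-SR♭∃ at `(n, p)`
  (both regimes) for EVERY door, the global correction being `c_p·Θᵖ` for the relative hyperplane class `Θ` (companion file, sufficient side).
* `PinnedHodgeDesignAt 𝒪 n p` — the same with `w` a rational class OF TYPE `(p,p)` OFF the Lefschetz span `Dᵖ(X) ⊗ ℂ` (instead of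
  algebraic): it implies REGIME 2 at `(n, p)` for every door, the datum being placed at the fibre where the class is exceptional (companion
  file). Under the Hodge conjecture for the fibres the first predicate implies the second.
* `DesignModLefschetzAt 𝒪 n p` — the DESIGN PROBLEM MODULO LEFSCHETZ CLASSES (necessary side): on every such `X`, for every rational algebraic
  class `w` that is NOT an algebraic Lefschetz class (`w ∉ Dᵖ(X) ⊗ ℂ = divisorClassesSpan X n p`), SOME COPY `X' ≅ X` carries an
  `𝒪`-admissible datum `(I ∋ p, κ)` with `κ_p = e^*(a·w + z)`, `a ≠ 0`, `z` an algebraic Lefschetz class of `X`, and every `κ_q` (`q ∈ I`) of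
  type `(q,q)`. It FOLLOWS from regime 2 at `(n, p)` (companion file, necessary side: the constant pencil `X × 𝔸¹ → 𝔸¹`). «Some copy» because an
  object class `𝒪 : ObjClass` is a bare predicate, not assumed to respect isomorphisms; for a door that does
  the copy is immaterial (companion file, hypothesis stated inline).

Both design predicates are OPEN statements, HYPOTHESES wherever used, tagged `@[conjecture]` like the cells; nothing here says any of them, any
cell, K-SR♭∃, VHC, `HC_AV` or HC holds. References: [cite: Bloch1972Semiregularity, Remark (7.5)] (the form `a·z₀ + b·l₀ᵖ` — here
`a·w + c·θᵖ`) [cite: BuchweitzFlenner2003, §5 Thm. 5.1] [cite: vanGeemen1994HodgeAV, §2.4 and Thm. 4.11] (`B¹ = ℚ ⟹ Dᵖ = ℚ·θᵖ`; Weil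
classes are off `D²`) [cite: Andre1996Motifs, §1.1 (p. 10)] (polarisation classes).
-/

noncomputable section

open CategoryTheory CategoryTheory.Limits AlgebraicGeometry Topology

namespace Summit.HodgeConjecture.HodgeConjecture.Ring2.SemiregularRepresentatives

-- the cell's namespace repeats the summit name (`Summit.HodgeConjecture.HodgeConjecture…`), as in every `Ring2*` file
set_option linter.dupNamespace false

open Literature.AlgebraicGeometry Literature.AlgebraicGeometry.Motives
open Literature.AlgebraicGeometry.HodgeTheory
open Literature.AlgebraicTopology.SingularHomology
open Literature.Barriers.HodgeConjecture (divisorClassesSpan)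
open Summit.Ventures.HSemireg (ObjClass)

/-- **The PINNED DESIGN PROBLEM of the cell `(n, p)` for the door `𝒪` (`PinnedDesignAt 𝒪 n p`)** — the route's «pinned design problem per
cell» as ONE statement about ONE abelian variety at a time: for every complex scheme `X` isomorphic to an abelian variety of dimension `n`,
every polarisation class `θ ∈ H²(X(ℂ); ℂ)` (rational, supported on a divisor, hard Lefschetz — `IsPolarizationClass n X θ`) and every
rational algebraic class `w ∈ H^{2p}(X(ℂ); ℂ)`, there are degrees `I ∋ p`, classes `κ` admissible for `𝒪` ON `X`, `a ≠ 0` and scalars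
`c_q` with `κ_p = a·w + c_p·θᵖ` and `κ_q = c_q·θ^q` for `q ∈ I`, `q ≠ p` (Bloch's `a·z₀ + b·l₀ᵖ` with every side component on the
`θ`-ray). SUFFICIENT for K-SR♭∃ at `(n, p)` for every door (companion file); OPEN for the road's doors at every `(n, p)` with
`2 ≤ p ≤ n − 2` off the `θ`-ray; a HYPOTHESIS wherever used. [cite: Bloch1972Semiregularity, Remark (7.5)]
[cite: vanGeemen1994HodgeAV, §2.4] [cite: Andre1996Motifs, §1.1 (p. 10)] -/
@[conjecture] def PinnedDesignAt (𝒪 : ObjClass) (n p : ℕ) : Prop :=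
  ∀ (X : SchemeOver ℂ), (∃ A : AbelianVariety ℂ, A.dim = n ∧ Nonempty (A.X ≅ X)) →
    ∀ (θ : complexBetti X 2), IsPolarizationClass n X θ →
    ∀ (w : complexBetti X (2 * p)), IsRationalClass w → w ∈ algebraicClasses X p →
      ∃ (I : Finset ℕ) (κ : (q : ℕ) → complexBetti X (2 * q)) (a : ℂ) (c : ℕ → ℂ),
        p ∈ I ∧ 𝒪 n X I κ ∧ a ≠ 0 ∧ κ p = a • w + c p • cupPowTwo θ p ∧
        ∀ q ∈ I, q ≠ p → κ q = c q • cupPowTwo θ q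

/-- **The PINNED HODGE DESIGN PROBLEM of the cell `(n, p)` for the door `𝒪` (`PinnedHodgeDesignAt 𝒪 n p`)**: as `PinnedDesignAt 𝒪 n p`, but
for the rational classes `w ∈ H^{2p}(X(ℂ); ℂ)` OF TYPE `(p,p)` that are NOT algebraic Lefschetz classes (`w ∉ Dᵖ(X) ⊗ ℂ` — at a variety with
`B¹ = ℚ·θ` exactly the classes off the ray `ℂ·θᵖ`, van Geemen's exceptional classes): an `𝒪`-admissible datum ON `X` with
`κ_p = a·w + c_p·θᵖ`, `a ≠ 0`, `κ_q = c_q·θ^q` (`q ∈ I`, `q ≠ p`). SUFFICIENT for REGIME 2 of K-SR♭∃ at `(n, p)` for every door (companion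
file: the datum sits at the fibre where the class is exceptional); implied by `PinnedDesignAt 𝒪 n p` granted the Hodge conjecture in
codimension `p` for the varieties concerned; OPEN; a HYPOTHESIS wherever used. [cite: Bloch1972Semiregularity, Remark (7.5)]
[cite: vanGeemen1994HodgeAV, §2.4 and Thm. 4.11] [cite: Andre1996Motifs, §1.1 (p. 10)] -/
@[conjecture] def PinnedHodgeDesignAt (𝒪 : ObjClass) (n p : ℕ) : Prop :=
  ∀ (X : SchemeOver ℂ), (∃ A : AbelianVariety ℂ, A.dim = n ∧ Nonempty (A.X ≅ X)) →
    ∀ (θ : complexBetti X 2), IsPolarizationClass n X θ →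
    ∀ (w : complexBetti X (2 * p)), IsRationalClass w → IsOfHodgeType n X (2 * p) p p w →
      w ∉ divisorClassesSpan X n p →
      ∃ (I : Finset ℕ) (κ : (q : ℕ) → complexBetti X (2 * q)) (a : ℂ) (c : ℕ → ℂ),
        p ∈ I ∧ 𝒪 n X I κ ∧ a ≠ 0 ∧ κ p = a • w + c p • cupPowTwo θ p ∧
        ∀ q ∈ I, q ≠ p → κ q = c q • cupPowTwo θ q

/-- **The DESIGN PROBLEM MODULO LEFSCHETZ CLASSES of the cell `(n, p)` for the door `𝒪` (`DesignModLefschetzAt 𝒪 n p`)**: for every complex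
scheme `X` isomorphic to an abelian variety of dimension `n` and every rational ALGEBRAIC class `w ∈ H^{2p}(X(ℂ); ℂ)` that is
NOT an algebraic Lefschetz class (`w ∉ Dᵖ(X) ⊗ ℂ`), SOME COPY `e : X' ≅ X` carries degrees `I ∋ p` and classes `κ` admissible for `𝒪` on
`X'` with `κ_p = e^*(a·w + z)`, `a ≠ 0`, `z ∈ H^{2p}(X(ℂ); ℂ)` an ALGEBRAIC LEFSCHETZ class, and `κ_q` of type `(q,q)` for every `q ∈ I`.
NECESSARY for regime 2 of K-SR♭∃ at `(n, p)` (companion file: the constant pencil `X × 𝔸¹`); a refutation at one `(X, w)` refutes the cell.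
OPEN; a HYPOTHESIS wherever used. [cite: Bloch1972Semiregularity, Remark (7.5)] [cite: vanGeemen1994HodgeAV, §2.4 and Thm. 4.11] -/
@[conjecture] def DesignModLefschetzAt (𝒪 : ObjClass) (n p : ℕ) : Prop :=
  ∀ (X : SchemeOver ℂ), (∃ A : AbelianVariety ℂ, A.dim = n ∧ Nonempty (A.X ≅ X)) →
    ∀ (w : complexBetti X (2 * p)), IsRationalClass w → w ∈ algebraicClasses X p → w ∉ divisorClassesSpan X n p →
      ∃ (X' : SchemeOver ℂ) (e : X' ≅ X) (I : Finset ℕ) (κ : (q : ℕ) → complexBetti X' (2 * q)) (a : ℂ)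
        (z : complexBetti X (2 * p)),
        p ∈ I ∧ 𝒪 n X' I κ ∧ a ≠ 0 ∧ z ∈ algebraicClasses X p ∧ z ∈ divisorClassesSpan X n p ∧
        κ p = complexBetti.map e.hom (2 * p) (a • w + z) ∧
        ∀ q ∈ I, IsOfHodgeType n X' (2 * q) q q (κ q)

end Summit.HodgeConjecture.HodgeConjecture.Ring2.SemiregularRepresentatives

end
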